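import Summits.ValiantsHypothesis.ValiantsHypothesis.Theorems.BarrierLeverGradientGenericFibreCountJacobian

/-!
# Route BarrierLever — item `GradientGenericFibreCount` (stmt-ValiantsHypothesis-19256),
# part 6/6: `GenericRadical` (generic fibre of `F = H + lower` is reduced) and the item

Route J of the cell memo (ROUTE-MEMO-p2-g4 §4b), second half, and the assembly:

* `mem_span_of_isHomogeneous_of_lt` — `(H)_t = S_t` above the top degree `k(e-1)` of `S/(H)`
  (from the Hilbert count of part 3);
* `finite_over_range` (**J-c1**) — `ℂ[x]` is a finite module over the subalgebra
  `ℂ[F_1, …, F_k]` (top-down reduction: the monomials of degree `≤ k(e-1)` generate);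
* `exists_multiple_of_ne_zero` (**J-c2**) — every non-zero `x ∈ ℂ[x]` divides the image of some
  non-zero `a₀ ∈ ℂ[y]` under `y ↦ F` (constant term of an integral relation);
* `genericRadical_holds : GenericRadical` — all fibres of `F` are non-empty (the quotient has
  dimension `e^k ≠ 0`, part 3 `finrank_quotient_eq_pow`), so `F` is algebraically independent
  (part 5, J-a) and its Jacobian determinant `Δ` is non-zero (tree
  `JacobianCriterion.det_jacobianMatrix_ne_zero_of_algebraicIndependent`); `a₀(F) = q·Δ` with
  `a₀ ≠ 0` (J-c2); over any `c` with `a₀(c) ≠ 0`, `Δ` vanishes nowhere on the fibre, so it is a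
  unit modulo `(F - c)` (part 5, J-e) and `(F - c)` is radical (part 5, J-d);
* **`gradientGenericFibreCount`** = the signature of item stmt-ValiantsHypothesis-19256 VERBATIM,
  by `item19256_of mreg_holds genericRadical_holds` (parts 3 and 4).

Reading: for `g ∈ ℂ[x_1, …, x_k]` of degree `≤ d`, `d ≥ 3`, whose top form has a gradient with only
the trivial common zero, some fibre `{x : ∇g(x) = c}` of the gradient map is finite with at least
`(d-1)^k` points (in fact exactly `(d-1)^k`, reduced) — the affine Bezout count for square systems
without zeros at infinity, with generic reducedness by the Jacobian/Kähler criterion instead of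
generic smoothness.

Lean text authored by the cell planner seat `valiant-natproofs-p2` (gen 4, HOME/HBasis-p2g4.lean,
1431 lines, kernel-checked rc 0 / 0 sorries; referee REF-G12 §4 and REF-G13 §2 PASS incl. full
line-read), ported by the prover seats (namespace `…Theorems.BarrierLever.HBasis`, six files, split
only; parts 1–4 by the `valiant-natproofs-prover` seat, parts 5–6 by `val-np-p1`).

WHAT THIS IS NOT: nothing here touches FSV Question 6 / crux stmt-14610 or `VP` vs `VNP`; the item
is the algebro-geometric half of `NaturalProofsAgainstAllLinearSizes` (stmt-20156), whose
complexity half is `NaturalProofsAgainstAllLinearSizesOfCount` (stmt-19261, closed).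

References: Macaulay 1916 (H-bases); [CoxLittleOSheaUsing2005] Ch. 3 Thm. (5.5); Hartshorne III
Cor. 10.7 (generic smoothness, replaced here by the Jacobian/Kähler argument); tree files
`Algebra.Polynomial.JacobianCriterion`, `ZeroDimensional.FinitenessTheorem`.
-/

-- layout Summits/ValiantsHypothesis/ValiantsHypothesis forces the duplicated namespace component
set_option linter.dupNamespace false

open MvPolynomial Finset

namespace Summit.ValiantsHypothesis.ValiantsHypothesis.Theorems.BarrierLever.HBasis

/-! ## The stub `GenericRadical`, proved (route J: finiteness over `ℂ[F]` + Jacobian/Kähler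
criterion), and the item -/

section GenericRadicalWork

open Module

/-- `(H)_t = S_t` above the top degree `k(e-1)` of `S/(H)`. -/
theorem mem_span_of_isHomogeneous_of_lt {k e : ℕ} (hk : 1 ≤ k) (H : Fin k → MvPolynomial (Fin k) ℂ)
    (hH : ∀ i, (H i).IsHomogeneous e) (hH0 : ∀ i, H i ≠ 0)
    (hnzd : ∀ j : Fin k, ∀ f, H j * f ∈ prefixIdeal H j → f ∈ prefixIdeal H j)
    {t : ℕ} (ht : k * (e - 1) < t) {m : MvPolynomial (Fin k) ℂ} (hm : m.IsHomogeneous t) :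
    m ∈ Ideal.span (Set.range H) := by
  obtain ⟨hzero, -⟩ := hilb_count hk H hH hH0 hnzd
  haveI := Literature.RingTheory.MvPolynomial.finite_homogeneousSubmodule (K := ℂ) (σ := Fin k) t
  have hle : Literature.RingTheory.MvPolynomial.idealDegree (Ideal.span (Set.range H)) t ≤
      homogeneousSubmodule (Fin k) ℂ t := inf_le_right
  have hfin : finrank ℂ (Literature.RingTheory.MvPolynomial.idealDegree (Ideal.span (Set.range H)) t) =
      finrank ℂ (homogeneousSubmodule (Fin k) ℂ t) := by
    have h1 := hzero t ht
    have h2 := Literature.RingTheory.MvPolynomial.finrank_idealDegree_le (Ideal.span (Set.range H)) t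
    simp only [hilb] at h1
    omega
  have heq := Submodule.eq_of_le_of_finrank_eq hle hfin
  have hm' : m ∈ Literature.RingTheory.MvPolynomial.idealDegree (Ideal.span (Set.range H)) t := by
    rw [heq]; exact hm
  exact hm'.1

/-- **J-c1.** `ℂ[x]` is a finite module over the subalgebra `ℂ[F_1, …, F_k]` (top-down reduction:
`(H)_t = S_t` for `t > k(e-1)`, so the monomials of degree `≤ k(e-1)` generate). -/
theorem finite_over_range {k e : ℕ} (hk : 1 ≤ k) (he : 1 ≤ e)
    (H F : Fin k → MvPolynomial (Fin k) ℂ)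
    (hH : ∀ i, (H i).IsHomogeneous e) (hF : ∀ i, (F i - H i).totalDegree < e)
    (hH0 : ∀ i, H i ≠ 0)
    (hnzd : ∀ j : Fin k, ∀ f, H j * f ∈ prefixIdeal H j → f ∈ prefixIdeal H j) :
    Module.Finite ↥(MvPolynomial.aeval F : MvPolynomial (Fin k) ℂ →ₐ[ℂ] MvPolynomial (Fin k) ℂ).range
      (MvPolynomial (Fin k) ℂ) := by
  classical
  set R₀ := (MvPolynomial.aeval F : MvPolynomial (Fin k) ℂ →ₐ[ℂ] MvPolynomial (Fin k) ℂ).range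
    with hR₀
  have hsm : ∀ (r : R₀) (p : MvPolynomial (Fin k) ℂ), r • p = (r : MvPolynomial (Fin k) ℂ) * p :=
    fun r p => by rw [Algebra.smul_def, Subalgebra.algebraMap_eq]; rfl
  have hFmem : ∀ i, F i ∈ R₀ := fun i => ⟨X i, by simp⟩
  have hCmem : ∀ c : ℂ, C c ∈ R₀ := fun c => ⟨C c, by simp⟩
  have heT : e - 1 ≤ k * (e - 1) := Nat.le_mul_of_pos_left (e - 1) hk
  have hdegF : ∀ i, (F i).totalDegree ≤ e := by
    intro i
    have : F i = (F i - H i) + H i := (sub_add_cancel _ _).symm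
    rw [this]
    exact (totalDegree_add _ _).trans (max_le (hF i).le (hH i).totalDegree_le)
  obtain ⟨s, hs⟩ : (restrictTotalDegree (Fin k) ℂ (k * (e - 1))).FG :=
    Module.Finite.iff_fg.1 inferInstance
  set N : Submodule R₀ (MvPolynomial (Fin k) ℂ) :=
    Submodule.span R₀ (s : Set (MvPolynomial (Fin k) ℂ)) with hN
  -- base case: degree `≤ k(e-1)`
  have base : ∀ p : MvPolynomial (Fin k) ℂ, p.totalDegree ≤ k * (e - 1) → p ∈ N := by
    intro p hp
    have hpV : p ∈ restrictTotalDegree (Fin k) ℂ (k * (e - 1)) := by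
      rw [mem_restrictTotalDegree]; exact hp
    rw [← hs] at hpV
    refine Submodule.span_induction (p := fun q _ => q ∈ N) (fun q hq => Submodule.subset_span hq)
      (Submodule.zero_mem N) (fun a b _ _ ha hb => Submodule.add_mem N ha hb) (fun c q _ hq => ?_) hpV
    have : c • q = (⟨C c, hCmem c⟩ : R₀) • q := by rw [hsm, MvPolynomial.smul_eq_C_mul]
    rw [this]; exact Submodule.smul_mem N _ hq
  -- top-down reduction
  have main : ∀ n (p : MvPolynomial (Fin k) ℂ), p.totalDegree ≤ n → p ∈ N := by
    intro n
    induction n using Nat.strong_induction_on with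
    | _ n ih =>
      intro p hpn
      by_cases hpT : p.totalDegree ≤ k * (e - 1)
      · exact base p hpT
      push Not at hpT
      set t := p.totalDegree with ht_def
      have het : e ≤ t := by omega
      have hpt : homogeneousComponent t p ∈ Ideal.span (Set.range H) :=
        mem_span_of_isHomogeneous_of_lt hk H hH hH0 hnzd hpT (homogeneousComponent_isHomogeneous t p)
      obtain ⟨a, ha⟩ := Ideal.mem_span_range_iff_exists_fun.1 hpt
      set a' : Fin k → MvPolynomial (Fin k) ℂ := fun i => homogeneousComponent (t - e) (a i)
        with ha'_def
      have ha'hom : ∀ i, (a' i).IsHomogeneous (t - e) := fun i =>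
        homogeneousComponent_isHomogeneous _ _
      have ha'sum : ∑ i, a' i * H i = homogeneousComponent t p := by
        have h1 := congr_arg (homogeneousComponent t) ha
        rw [homogeneousComponent_eq_self (homogeneousComponent_isHomogeneous t p), map_sum] at h1
        rw [← h1]
        refine Finset.sum_congr rfl fun i _ => ?_
        rw [homogeneousComponent_mul_form (hH i), if_pos het]
      set p' := p - ∑ i, a' i * F i with hp'_def
      have hp'N : p' ∈ N := by
        by_cases h0 : p' = 0
        · rw [h0]; exact Submodule.zero_mem N
        have hle : p'.totalDegree ≤ t := by
          rw [hp'_def]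
          refine (totalDegree_sub _ _).trans (max_le le_rfl ?_)
          refine (totalDegree_finsetSum _ _).trans (Finset.sup_le fun i _ => ?_)
          refine (totalDegree_mul _ _).trans ?_
          calc (a' i).totalDegree + (F i).totalDegree ≤ (t - e) + e :=
                add_le_add (ha'hom i).totalDegree_le (hdegF i)
            _ = t := Nat.sub_add_cancel het
        have hzero : homogeneousComponent t p' = 0 := by
          rw [hp'_def, map_sub, homogeneousComponent_sum_mul H F hH hF a', sub_eq_zero, ← ha'sum]
          · refine Finset.sum_congr rfl fun i _ => ?_
            rw [homogeneousComponent_eq_self (ha'hom i)]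
          · intro i _
            calc (a' i).totalDegree + e ≤ (t - e) + e := add_le_add (ha'hom i).totalDegree_le le_rfl
              _ = t := Nat.sub_add_cancel het
        have hlt := totalDegree_lt_of_homogeneousComponent_eq_zero h0 hle hzero
        exact ih p'.totalDegree (lt_of_lt_of_le hlt hpn) p' le_rfl
      have ha'N : ∀ i, a' i ∈ N := by
        intro i
        refine ih (t - e) ?_ (a' i) (ha'hom i).totalDegree_le
        omega
      have hsumN : ∑ i, a' i * F i ∈ N := by
        refine Submodule.sum_mem N fun i _ => ?_
        have : a' i * F i = (⟨F i, hFmem i⟩ : R₀) • a' i := by rw [hsm, mul_comm]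
        rw [this]; exact Submodule.smul_mem N _ (ha'N i)
      have : p = p' + ∑ i, a' i * F i := by rw [hp'_def, sub_add_cancel]
      rw [this]
      exact Submodule.add_mem N hp'N hsumN
  exact ⟨⟨s, Submodule.eq_top_iff'.2 fun p => main p.totalDegree p le_rfl⟩⟩

/-- **J-c2.** For every non-zero `x ∈ ℂ[x]` some non-zero `a₀ ∈ ℂ[y]` maps, under `y ↦ F`, to a
multiple of `x` (constant term of a minimal-type integral relation of `x` over `ℂ[F]`). -/
theorem exists_multiple_of_ne_zero {k e : ℕ} (hk : 1 ≤ k) (he : 1 ≤ e)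
    (H F : Fin k → MvPolynomial (Fin k) ℂ)
    (hH : ∀ i, (H i).IsHomogeneous e) (hF : ∀ i, (F i - H i).totalDegree < e)
    (hH0 : ∀ i, H i ≠ 0)
    (hnzd : ∀ j : Fin k, ∀ f, H j * f ∈ prefixIdeal H j → f ∈ prefixIdeal H j)
    {x : MvPolynomial (Fin k) ℂ} (hx : x ≠ 0) :
    ∃ a₀ : MvPolynomial (Fin k) ℂ, a₀ ≠ 0 ∧ ∃ q : MvPolynomial (Fin k) ℂ,
      MvPolynomial.aeval F a₀ = q * x := by
  classical
  haveI := finite_over_range hk he H F hH hF hH0 hnzd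
  set R₀ := (MvPolynomial.aeval F : MvPolynomial (Fin k) ℂ →ₐ[ℂ] MvPolynomial (Fin k) ℂ).range
    with hR₀
  have hint : IsIntegral R₀ x := Algebra.IsIntegral.isIntegral x
  obtain ⟨P, hPm, hP⟩ := hint
  have hP0 : P ≠ 0 := hPm.ne_zero
  obtain ⟨Q, hPQ, hndvd⟩ := Polynomial.exists_eq_pow_rootMultiplicity_mul_and_not_dvd P hP0 0
  rw [map_zero, sub_zero] at hPQ hndvd
  have hQ0 : Q.coeff 0 ≠ 0 := fun h => hndvd (Polynomial.X_dvd_iff.2 h)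
  have hQeval : Polynomial.eval₂ (algebraMap R₀ (MvPolynomial (Fin k) ℂ)) x Q = 0 := by
    rw [hPQ, Polynomial.eval₂_mul, Polynomial.eval₂_pow, Polynomial.eval₂_X] at hP
    exact (mul_eq_zero.1 hP).resolve_left (pow_ne_zero _ hx)
  rw [← Polynomial.divX_mul_X_add Q, Polynomial.eval₂_add, Polynomial.eval₂_mul, Polynomial.eval₂_X,
    Polynomial.eval₂_C] at hQeval
  have hcoe : (algebraMap R₀ (MvPolynomial (Fin k) ℂ)) (Q.coeff 0) =
      ((Q.coeff 0 : R₀) : MvPolynomial (Fin k) ℂ) := by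
    rw [Subalgebra.algebraMap_eq]; rfl
  rw [hcoe] at hQeval
  obtain ⟨a₀, ha₀⟩ := (AlgHom.mem_range _).1 (Q.coeff 0).2
  refine ⟨a₀, ?_, -Polynomial.eval₂ (algebraMap R₀ (MvPolynomial (Fin k) ℂ)) x Q.divX, ?_⟩
  · intro h
    apply hQ0
    have h0 : ((Q.coeff 0 : R₀) : MvPolynomial (Fin k) ℂ) = 0 := by rw [← ha₀, h, map_zero]
    exact Subtype.ext h0
  · rw [ha₀]
    linear_combination hQeval

/-- **GenericRadical, proved** (route J: finiteness over `ℂ[F]` + Jacobian/Kähler criterion). -/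
theorem genericRadical_holds : GenericRadical := by
  classical
  intro k e hk he H F hH hF hH0 hnzd hK
  have hFc : ∀ c : Fin k → ℂ, ∀ i, ((F i - C (c i)) - H i).totalDegree < e := by
    intro c i
    have : F i - C (c i) - H i = (F i - H i) - C (c i) := by ring
    rw [this]
    refine lt_of_le_of_lt (totalDegree_sub _ _) (max_lt (hF i) ?_)
    rw [totalDegree_C]; omega
  -- every fibre is non-empty
  have hsurj : ∀ c : Fin k → ℂ, ∃ x : Fin k → ℂ, ∀ i, eval x (F i) = c i := by
    intro c
    obtain ⟨-, hrank⟩ :=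
      finrank_quotient_eq_pow hk he H (fun i => F i - C (c i)) hH (hFc c) hH0 hnzd hK
    have hne : Ideal.span (Set.range fun i => F i - C (c i)) ≠ ⊤ := by
      intro htop
      haveI : Subsingleton (MvPolynomial (Fin k) ℂ ⧸ Ideal.span (Set.range fun i => F i - C (c i))) :=
        Ideal.Quotient.subsingleton_iff.2 htop
      rw [Module.finrank_zero_of_subsingleton] at hrank
      exact absurd hrank.symm (pow_ne_zero k (by omega))
    obtain ⟨x, hx⟩ := exists_zero_of_ne_top hne
    refine ⟨x, fun i => ?_⟩
    have := hx (F i - C (c i)) (Ideal.subset_span (Set.mem_range_self (f := fun i => F i - C (c i)) i))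
    rwa [map_sub, eval_C, sub_eq_zero] at this
  have hind := algebraicIndependent_of_surjective F hsurj
  have hΔ := Literature.Algebra.Polynomial.JacobianCriterion.det_jacobianMatrix_ne_zero_of_algebraicIndependent
    F hind
  obtain ⟨a₀, ha₀, q, hq⟩ := exists_multiple_of_ne_zero hk he H F hH hF hH0 hnzd hΔ
  -- a value `c` with `a₀(c) ≠ 0`
  obtain ⟨c, hc⟩ : ∃ c : Fin k → ℂ, eval c a₀ ≠ 0 := by
    by_contra h
    push Not at h
    exact ha₀ (MvPolynomial.funext fun c => by rw [h c, map_zero])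
  refine ⟨c, ?_⟩
  -- on the fibre over `c`, `Δ` does not vanish
  have hfib : ∀ v : Fin k → ℂ, (∀ p ∈ Ideal.span (Set.range fun i => F i - C (c i)), eval v p = 0) →
      eval v (Literature.Algebra.Polynomial.JacobianCriterion.jacobianMatrix F).det ≠ 0 := by
    intro v hv hv0
    have hvF : ∀ i, eval v (F i) = c i := fun i => by
      have := hv (F i - C (c i))
        (Ideal.subset_span (Set.mem_range_self (f := fun i => F i - C (c i)) i))
      rwa [map_sub, eval_C, sub_eq_zero] at this
    have h1 : eval v (MvPolynomial.aeval F a₀) = eval c a₀ := by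
      have h2 : MvPolynomial.aeval v (MvPolynomial.aeval F a₀) =
          MvPolynomial.aeval (fun i => MvPolynomial.aeval v (F i)) a₀ := by
        rw [← AlgHom.comp_apply, MvPolynomial.comp_aeval]
      have h3 : (fun i => MvPolynomial.aeval v (F i)) = c := funext fun i => hvF i
      rw [h3] at h2
      exact h2
    apply hc
    rw [← h1, hq, map_mul, hv0, mul_zero]
  apply isRadical_of_isUnit_jacobian
  have hmat : (Matrix.of fun j i => pderiv i (F j - C (c j))) =
      Literature.Algebra.Polynomial.JacobianCriterion.jacobianMatrix F := by
    ext j i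
    simp [Literature.Algebra.Polynomial.JacobianCriterion.jacobianMatrix]
  rw [hmat]
  exact isUnit_mk_of_forall_eval_ne_zero hfib

/-- **Item `GradientGenericFibreCount` (stmt-ValiantsHypothesis-19256), signature VERBATIM** — the
generic gradient-fibre count: for `g ∈ ℂ[x_1, …, x_k]` of degree `≤ d` (`d ≥ 3`) whose top form
`g_d` has `∇g_d` with only the trivial common zero, some fibre `{x : ∇g(x) = c}` is finite with at
least `(d-1)^k` points. Assembly `item19256_of` (part 3) applied to `mreg_holds` (part 4) and
`genericRadical_holds` (this file). -/
theorem gradientGenericFibreCount :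
    ∀ k d : ℕ, 3 ≤ d → ∀ g : MvPolynomial (Fin k) ℂ, g.totalDegree ≤ d → (∀ ξ : Fin k → ℂ, (∀ i, MvPolynomial.eval ξ (MvPolynomial.pderiv i (MvPolynomial.homogeneousComponent d g)) = 0) → ξ = 0) → ∃ c : Fin k → ℂ, {x : Fin k → ℂ | ∀ i, MvPolynomial.eval x (MvPolynomial.pderiv i g) = c i}.Finite ∧ (d - 1) ^ k ≤ {x : Fin k → ℂ | ∀ i, MvPolynomial.eval x (MvPolynomial.pderiv i g) = c i}.ncard :=
  item19256_of mreg_holds genericRadical_holds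

end GenericRadicalWork

end Summit.ValiantsHypothesis.ValiantsHypothesis.Theorems.BarrierLever.HBasis
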